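import Summits.BirchSwinnertonDyer.BirchSwinnertonDyer.Theorems.EisensteinDepletionAtTwoStarOptBSFSigmaNodeSeventeen
import Summits.BirchSwinnertonDyer.BirchSwinnertonDyer.Theorems.EisensteinDepletionAtTwoStarOptBSFSigmaNodePrime
import Summits.BirchSwinnertonDyer.BirchSwinnertonDyer.Theorems.EisensteinDepletionAtTwoStarOptBSFMidWalk
import HarnessLib

/-!
# Line `star` on crux E1M (stmt-BirchSwinnertonDyer-20341): THE NODE-LAW DOOR — the whole squarefree residue `stub_starOptBSF` from the node law (N256) and prints

Lead star-p1 GEN 17, end state.  The squarefree half of `StarOptB` (v6's `stub_starOptBSF`: the lattice-optimal curve of a habitat class at squarefree `N ≠ 15` has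
an odd étale rational 2-torsion abscissa) follows from GEN 15's print-free door `SfPositions.starOptBSF_of_positions` ((T1) ∧ (T2)), and after GEN 17 both position
laws are consequences of ONE research statement, the NODE LAW
  (N256) «a formal Σ-type rational 2-torsion abscissa `r` of the lattice-optimal `W₀` has complementary discriminant `(b₂ + 12r)² − 32(b₄ + r b₂ + 6r²) = ±256»,
plus prints: (T1) ⇐ (N256) + UBD + Edixhoven (`SigmaNode.optimalNotTypeA_of_sigmaNode`); (T2) ⇐ (T2′) (the MID walk, `MidWalk.optimalNotMidPointed_of_partnerNotCentre`)
and (T2′) ⇐ (N256) + UBD + Edixhoven + Setzer + Cremona-17 (`SigmaNode.partnerNotCentre_of_sigmaNode_of_prints`).  Moreover (N256) itself is needed only OFF the prime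
levels `≠ 17` (`SigmaNode.sigmaNode_of_prime_conductor`, mod Setzer).  This file records the three doors BY NAME:

* `optimalNotMidPointed_of_sigmaNode_of_prints` — (T2) VERBATIM ⇐ (N256) + {UBD, Edixhoven, Setzer, Cremona-17};
* `starOptBSF_of_sigmaNode_of_prints` — `stub_starOptBSF` VERBATIM ⇐ (N256) + the same four prints;
* `sigmaNode_of_compositeOr17_of_setzer` — (N256) at all levels ⇐ (N256) at levels that are not primes `≠ 17` + Setzer.

So E1M at squarefree level = (N256 off the Setzer levels) + prints; its source in print would be «J₁(N) has connected fibres at p ∥ N» (Conrad–Edixhoven–Stein 2003 at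
prime level; open at composite level).  CONDITIONAL on the prints and on (N256); no `sorry`, no new definition; nothing here reads `r_an`; StarOptB / E1M / BSD NOT proved.
-/

set_option linter.dupNamespace false
set_option autoImplicit false

noncomputable section

open scoped Classical MatrixGroups
open CongruenceSubgroup
open WeierstrassCurve Literature.NumberTheory.EllipticCurves Literature.NumberTheory.EllipticCurves.Greenberg1999
open Literature.NumberTheory.EllipticCurves.ModularForms

namespace Summit.BirchSwinnertonDyer.BirchSwinnertonDyer.Theorems.DepletionAtTwo.SigmaNode

/-- **(T2) «no MID-pointed optimal curve in a habitat class at squarefree `N ≠ 15`» — the statement of the registered stub `stub_optimalNotMidPointed` VERBATIM —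
from the node law (N256) and the prints UBD, Edixhoven, Setzer, Cremona-17** (MID walk ∘ `partnerNotCentre_of_sigmaNode_of_prints`). CONDITIONAL on them.
[cite: GreenbergLNM1716, §5 Props. 5.13–5.14 (pp. 120–121)] [cite: Setzer1975, pp. 367–378] [cite: CremonaAlgorithms1997, Table 1 (N = 17)] -/
theorem optimalNotMidPointed_of_sigmaNode_of_prints
    (hU : Literature.NumberTheory.Automorphic.CalegariDimitrovTang2025_unboundedDenominators)
    (hEd : edixhoven_optimalManinConstant_integral) (hS : Setzer1975_primeConductor_rationalTwoTorsion)
    (hC : Cremona1997_conductor_seventeen_classification)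
    (hN : ∀ (W₀ : WeierstrassCurve ℚ) [W₀.IsElliptic] [W₀.IsGloballyMinimal]
      ⦃N : ℕ⦄ [NeZero N] (f : CuspForm (Gamma0 N) 2), IsNewformOf W₀ f → IsOrdinaryAt W₀ 2 →
      ∀ (L₀ : PeriodPair), IsNeronLatticeOf (W₀.baseChange ℂ) L₀ → ∀ (q : ℚ), q ≠ 0 →
      (∀ z ∈ periodLattice f, (q : ℂ) * z ∈ L₀.lattice) → (∀ z ∈ L₀.lattice, ∃ w ∈ periodLattice f, z = (q : ℂ) * w) →
      ∀ (x : ℚ), HasRationalTwoTorsionX W₀ x → TwoTorsionRamifiedAtTwo x →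
      ∀ (lam : ℂ), lam ∈ L₀.lattice → lam / 2 ∉ L₀.lattice →
        L₀.weierstrassP (lam / 2) - ((W₀.b₂ : ℚ) : ℂ) / 12 = ((x : ℚ) : ℂ) →
      (∀ (γ : SL(2, ℤ)) (hγ : γ ∈ Gamma0 N), γ ∈ Gamma1 N →
        ∃ k : ℤ, ∃ w ∈ L₀.lattice, (q : ℂ) * cuspSymbol f ⟨γ, hγ⟩ = (k : ℂ) * lam + 2 * w) →
      (W₀.b₂ + 12 * x) ^ 2 - 32 * (W₀.b₄ + x * W₀.b₂ + 6 * x ^ 2) = 256 ∨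
        (W₀.b₂ + 12 * x) ^ 2 - 32 * (W₀.b₄ + x * W₀.b₂ + 6 * x ^ 2) = -256) :
    ∀ (W : WeierstrassCurve ℚ) [W.IsElliptic] [W.IsGloballyMinimal] (x : ℚ), IsOrdinaryAt W 2 →
      HasUniqueRationalTwoTorsionX W x →
      ((TwoTorsionRamifiedAtTwo x ∧ ¬ TwoTorsionOdd W x) ∨ (TwoTorsionOdd W x ∧ ¬ TwoTorsionRamifiedAtTwo x)) →
      W.conductorNorm ℤ ≠ 15 → Squarefree (W.conductorNorm ℤ) →
      ∀ ⦃N : ℕ⦄ [NeZero N] (f : CuspForm (Gamma0 N) 2), IsNewformOf W f →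
      ∀ (W₀ : WeierstrassCurve ℚ) [W₀.IsElliptic] [W₀.IsGloballyMinimal], IsNewformOf W₀ f →
      ∀ (L₀ : PeriodPair), IsNeronLatticeOf (W₀.baseChange ℂ) L₀ → ∀ (q : ℚ), q ≠ 0 →
      (∀ z ∈ periodLattice f, (q : ℂ) * z ∈ L₀.lattice) → (∀ z ∈ L₀.lattice, ∃ w ∈ periodLattice f, z = (q : ℂ) * w) →
      ∀ (x₀ : ℚ), HasRationalTwoTorsionX W₀ x₀ → TwoTorsionRamifiedAtTwo x₀ → ¬ TwoTorsionOdd W₀ x₀ :=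
  MidWalk.optimalNotMidPointed_of_partnerNotCentre (partnerNotCentre_of_sigmaNode_of_prints hU hEd hS hC hN)

/-- **The squarefree residue `stub_starOptBSF` (v6: StarOptB at squarefree `N ≠ 15`) VERBATIM from the node law (N256) and the prints** — GEN 15's print-free door
`SfPositions.starOptBSF_of_positions` fed with (T1) (`optimalNotTypeA_of_sigmaNode`) and (T2) (`optimalNotMidPointed_of_sigmaNode_of_prints`). CONDITIONAL on them.
[cite: GreenbergLNM1716, §5 Props. 5.13–5.14 (pp. 120–121)] [cite: ConradEdixhovenStein2003, Thm. 1.1.1] -/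
theorem starOptBSF_of_sigmaNode_of_prints
    (hU : Literature.NumberTheory.Automorphic.CalegariDimitrovTang2025_unboundedDenominators)
    (hEd : edixhoven_optimalManinConstant_integral) (hS : Setzer1975_primeConductor_rationalTwoTorsion)
    (hC : Cremona1997_conductor_seventeen_classification)
    (hN : ∀ (W₀ : WeierstrassCurve ℚ) [W₀.IsElliptic] [W₀.IsGloballyMinimal]
      ⦃N : ℕ⦄ [NeZero N] (f : CuspForm (Gamma0 N) 2), IsNewformOf W₀ f → IsOrdinaryAt W₀ 2 →
      ∀ (L₀ : PeriodPair), IsNeronLatticeOf (W₀.baseChange ℂ) L₀ → ∀ (q : ℚ), q ≠ 0 →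
      (∀ z ∈ periodLattice f, (q : ℂ) * z ∈ L₀.lattice) → (∀ z ∈ L₀.lattice, ∃ w ∈ periodLattice f, z = (q : ℂ) * w) →
      ∀ (x : ℚ), HasRationalTwoTorsionX W₀ x → TwoTorsionRamifiedAtTwo x →
      ∀ (lam : ℂ), lam ∈ L₀.lattice → lam / 2 ∉ L₀.lattice →
        L₀.weierstrassP (lam / 2) - ((W₀.b₂ : ℚ) : ℂ) / 12 = ((x : ℚ) : ℂ) →
      (∀ (γ : SL(2, ℤ)) (hγ : γ ∈ Gamma0 N), γ ∈ Gamma1 N →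
        ∃ k : ℤ, ∃ w ∈ L₀.lattice, (q : ℂ) * cuspSymbol f ⟨γ, hγ⟩ = (k : ℂ) * lam + 2 * w) →
      (W₀.b₂ + 12 * x) ^ 2 - 32 * (W₀.b₄ + x * W₀.b₂ + 6 * x ^ 2) = 256 ∨
        (W₀.b₂ + 12 * x) ^ 2 - 32 * (W₀.b₄ + x * W₀.b₂ + 6 * x ^ 2) = -256) :
    ∀ (W : WeierstrassCurve ℚ) [W.IsElliptic] [W.IsGloballyMinimal] (x : ℚ), IsOrdinaryAt W 2 →
      HasUniqueRationalTwoTorsionX W x →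
      ((TwoTorsionRamifiedAtTwo x ∧ ¬ TwoTorsionOdd W x) ∨ (TwoTorsionOdd W x ∧ ¬ TwoTorsionRamifiedAtTwo x)) →
      W.conductorNorm ℤ ≠ 15 → Squarefree (W.conductorNorm ℤ) →
      ∀ ⦃N : ℕ⦄ [NeZero N] (f : CuspForm (Gamma0 N) 2), IsNewformOf W f →
      ∀ (W₀ : WeierstrassCurve ℚ) [W₀.IsElliptic] [W₀.IsGloballyMinimal], IsNewformOf W₀ f →
      ∀ (L₀ : PeriodPair), IsNeronLatticeOf (W₀.baseChange ℂ) L₀ → ∀ (q : ℚ), q ≠ 0 →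
      (∀ z ∈ periodLattice f, (q : ℂ) * z ∈ L₀.lattice) → (∀ z ∈ L₀.lattice, ∃ w ∈ periodLattice f, z = (q : ℂ) * w) →
      ∃ x₀ : ℚ, HasRationalTwoTorsionX W₀ x₀ ∧ TwoTorsionOdd W₀ x₀ ∧ ¬ TwoTorsionRamifiedAtTwo x₀ :=
  SfPositions.starOptBSF_of_positions (optimalNotTypeA_of_sigmaNode hU hEd hN) (optimalNotMidPointed_of_sigmaNode_of_prints hU hEd hS hC hN)

/-- **(N256) at all levels from (N256) off the prime levels `≠ 17` and Setzer** (`sigmaNode_of_prime_conductor`). CONDITIONAL on both.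
[cite: Setzer1975, pp. 367–378 (main theorem)] [cite: ConradEdixhovenStein2003, Thm. 1.1.1] -/
theorem sigmaNode_of_compositeOr17_of_setzer (hS : Setzer1975_primeConductor_rationalTwoTorsion)
    (hNC : ∀ (W₀ : WeierstrassCurve ℚ) [W₀.IsElliptic] [W₀.IsGloballyMinimal],
      (¬ (W₀.conductorNorm ℤ).Prime ∨ W₀.conductorNorm ℤ = 17) →
      ∀ ⦃N : ℕ⦄ [NeZero N] (f : CuspForm (Gamma0 N) 2), IsNewformOf W₀ f → IsOrdinaryAt W₀ 2 →
      ∀ (L₀ : PeriodPair), IsNeronLatticeOf (W₀.baseChange ℂ) L₀ → ∀ (q : ℚ), q ≠ 0 →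
      (∀ z ∈ periodLattice f, (q : ℂ) * z ∈ L₀.lattice) → (∀ z ∈ L₀.lattice, ∃ w ∈ periodLattice f, z = (q : ℂ) * w) →
      ∀ (x : ℚ), HasRationalTwoTorsionX W₀ x → TwoTorsionRamifiedAtTwo x →
      ∀ (lam : ℂ), lam ∈ L₀.lattice → lam / 2 ∉ L₀.lattice →
        L₀.weierstrassP (lam / 2) - ((W₀.b₂ : ℚ) : ℂ) / 12 = ((x : ℚ) : ℂ) →
      (∀ (γ : SL(2, ℤ)) (hγ : γ ∈ Gamma0 N), γ ∈ Gamma1 N →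
        ∃ k : ℤ, ∃ w ∈ L₀.lattice, (q : ℂ) * cuspSymbol f ⟨γ, hγ⟩ = (k : ℂ) * lam + 2 * w) →
      (W₀.b₂ + 12 * x) ^ 2 - 32 * (W₀.b₄ + x * W₀.b₂ + 6 * x ^ 2) = 256 ∨
        (W₀.b₂ + 12 * x) ^ 2 - 32 * (W₀.b₄ + x * W₀.b₂ + 6 * x ^ 2) = -256) :
    ∀ (W₀ : WeierstrassCurve ℚ) [W₀.IsElliptic] [W₀.IsGloballyMinimal]
      ⦃N : ℕ⦄ [NeZero N] (f : CuspForm (Gamma0 N) 2), IsNewformOf W₀ f → IsOrdinaryAt W₀ 2 →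
      ∀ (L₀ : PeriodPair), IsNeronLatticeOf (W₀.baseChange ℂ) L₀ → ∀ (q : ℚ), q ≠ 0 →
      (∀ z ∈ periodLattice f, (q : ℂ) * z ∈ L₀.lattice) → (∀ z ∈ L₀.lattice, ∃ w ∈ periodLattice f, z = (q : ℂ) * w) →
      ∀ (x : ℚ), HasRationalTwoTorsionX W₀ x → TwoTorsionRamifiedAtTwo x →
      ∀ (lam : ℂ), lam ∈ L₀.lattice → lam / 2 ∉ L₀.lattice →
        L₀.weierstrassP (lam / 2) - ((W₀.b₂ : ℚ) : ℂ) / 12 = ((x : ℚ) : ℂ) →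
      (∀ (γ : SL(2, ℤ)) (hγ : γ ∈ Gamma0 N), γ ∈ Gamma1 N →
        ∃ k : ℤ, ∃ w ∈ L₀.lattice, (q : ℂ) * cuspSymbol f ⟨γ, hγ⟩ = (k : ℂ) * lam + 2 * w) →
      (W₀.b₂ + 12 * x) ^ 2 - 32 * (W₀.b₄ + x * W₀.b₂ + 6 * x ^ 2) = 256 ∨
        (W₀.b₂ + 12 * x) ^ 2 - 32 * (W₀.b₄ + x * W₀.b₂ + 6 * x ^ 2) = -256 := by
  intro W₀ _ _ N _ f hW₀ hord L₀ hL₀ q hq hin hout x hx hram lam hlam hlam2 hwp hpar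
  by_cases hp : (W₀.conductorNorm ℤ).Prime ∧ W₀.conductorNorm ℤ ≠ 17
  · exact sigmaNode_of_prime_conductor hS W₀ hp.1 hp.2 f hW₀ hord L₀ hL₀ q hq hin hout x hx hram lam hlam hlam2 hwp hpar
  · have h' : ¬ (W₀.conductorNorm ℤ).Prime ∨ W₀.conductorNorm ℤ = 17 := by
      by_cases h1 : (W₀.conductorNorm ℤ).Prime
      · right; by_contra h2; exact hp ⟨h1, h2⟩
      · left; exact h1
    exact hNC W₀ h' f hW₀ hord L₀ hL₀ q hq hin hout x hx hram lam hlam hlam2 hwp hpar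

end Summit.BirchSwinnertonDyer.BirchSwinnertonDyer.Theorems.DepletionAtTwo.SigmaNode

end
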